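import Literature.MathematicalPhysics.QuantumFieldTheory.Balaban1983to89.B8Prop5GaugeParamKLevel
import Literature.MathematicalPhysics.QuantumFieldTheory.Balaban1983to89.B8Prop5TraceFree

/-!
# `Balaban1983to89.B8Prop5GaugeParamTraceFree` — [Balaban1985RegularSpaces] Sect. D pp. 93–94, Prop. 5 (1.107)–(1.108) p. 94: THE GAUGE
# PARAMETER `λ′ = λ + H_c(λ)` OF PROPOSITION 5 AT `k` LEVELS IS `τ`-FREE (traceless) for every continuous tracial functional `τ`, as soon as
# the datum `D*A`, the Sect. E correction `H_c` and the letters `G′`, `R` are — `B8Prop5GaugeParamKLevel.gaugeParam_kLevel` (JOIN-A) with the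
# kernel clause of joint J-SU threaded through (layer 2a; layer 1 = `B8Prop5TraceFree`)

statement-level skeleton of published theorems with citation tags; proofs where landed; nothing here is a claim about the
Yang–Mills mass gap

T. Bałaban, *Spaces of regular gauge field configurations on a lattice and gauge fixing conditions*, Commun. Math. Phys. **99** (1985)
75–102 `[Balaban1985RegularSpaces]` ("B8"; printed page = PDF page + 74): Sect. D (1.100)–(1.103) p. 93, Proposition 5 (1.107)–(1.108) p. 94,
(1.113)–(1.120) pp. 95–96; `𝔤`-valued gauge parameters p. 76 and (1.17) p. 78.  STATUS: published, refereed.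

CITATION HEADER (lean-in-tree rule).  Cell `lit-balaban`, seat `lit-balaban-t2s-1` (gen 0), sub-row «G-B8-T2S» (R3 `stmt-QuantumFields-19200`),
JOINT J-SU layer 2a (lead g29 2026-08-28T00:11:16Z (3); JOINT RULING #2 (R2): the consumer is hard-typed `Matrix.specialUnitaryGroup (Fin 2) ℂ`,
so Theorem 2's gauge transformation must be SU-valued, i.e. Proposition 5's `λ′` traceless).  WHAT IS REPRODUCED.  `B8Prop5GaugeParamKLevel.
gaugeParam_kLevel` delivers the fixed point `s` of (1.100) and the gauge parameter `s′` (`λ_{s′} = λ_s + H_c λ_s`, (1.108), Hermitian, supported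
on `Ω₀`, Neumann identity) WITH the defining fixed-point equation `λ_s = G′(Ψλ_s)` exposed; `B8Prop5TraceFree.propFive_fixedPoint_kLevel_traceFree`
(this seat, layer 1) makes that fixed point `τ`-free.  THIS FILE composes the two: **`gaugeParam_kLevel_traceFree`** = `gaugeParam_kLevel`'s
conclusion VERBATIM plus the clause `∀ x, τ(λ_{s′}(x)) = 0`, under the additional displayed hypotheses (T1) `τ(xy) = τ(yx)`, (T2)
`τ(log(eᵃeᵇ)) = τ(a) + τ(b)` (`‖a‖ + ‖b‖ ≤ ½`), `τ(D*A) = 0` on the `Ω_j`, `H_c` maps `τ`-free configurations of the ball to `τ`-free ones, and the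
letters `R`, `G′` are `τ`-compatible (on the `Ω_j` ∕ into configurations).  Lemmas: `apply_covDerivFwd`, `apply_covDeriv`, `apply_covLap` (the
stencils (1.1)–(1.2) preserve `τ`-free configurations at ANY background — conjugation is `τ`-invisible).

HONEST SCOPE.  Composition bookkeeping; nothing of Proposition 5 beyond the two inputs is claimed; the thread further up (`B8Prop5JoinHFP` →
`B8Prop5JoinSectELocal(RD)`, where `H_c = H′D′` is instantiated by Sect. E, → the `SockHFP` providers → `e^{iλ′} ∈ SU(N)`) and the discharge of
(T2) for `M_N(ℂ)` are the next layers.  Count-neutral; N05 ∕ `stub_PV3A` NOT discharged; nothing continuum ∕ ℝ⁴ ∕ OS ∕ mass-gap ∕ Clay.  No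
`sorry`, no `def`, no `… : Prop` fact, no `instance`, no `notation`.  Tree API by name only.
-/

noncomputable section

open NormedSpace Metric Set Filter Topology
open Complex (I)
open scoped BigOperators

namespace Literature.MathematicalPhysics.QuantumFieldTheory.Balaban1983to89.B8Prop5GaugeParamTraceFree

open MatrixLog (mlog)
open B7Prop1Explicit (e)
open B7Prop2Explicit (unitaryUnits)
open B7Eq78Linearization (conjR)
open B8Ineq132 (covDerivFwd covDeriv)
open B8Eq138LandauZd (covLap covDivB)
open B8LambdaSpaceKLevel (wt lamSubK lamOf)
open B8Prop5ContractionKLevel (Bd2 Zsol Vop Wsrc PsiP5 Mc Kc)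
open B8Prop5GaugeParamKLevel (gaugeParam_kLevel gpar_size gpar_grad gpar_lip)
open B8Prop5TraceFree (apply_conjR propFive_fixedPoint_kLevel_traceFree)

-- `Site` alone could resolve to the torus sites of `Setup.lean`; re-export the `ℤ^d` sites of `B7Prop1Explicit`.
export B7Prop1Explicit (Site)

variable {d : ℕ} {𝔸 : Type*} [CStarAlgebra 𝔸] [Nontrivial 𝔸]

/-! ## §1 The stencils (1.1)–(1.2) preserve `τ`-free configurations (any background) -/

section Stencils

variable (τ : 𝔸 →L[ℂ] ℂ)

omit [Nontrivial 𝔸] in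
/-- The forward covariant difference (1.1) of a `τ`-free configuration is `τ`-free (conjugation is `τ`-invisible under (T1)).
[cite: Balaban1985RegularSpaces, (1.1) p.76] -/
theorem apply_covDerivFwd (hτ : ∀ x y : 𝔸, τ (x * y) = τ (y * x)) {η : ℝ} (U₀ : Site d → Fin d → 𝔸ˣ) {f : Site d → 𝔸}
    (hf : ∀ x, τ (f x) = 0) (μ : Fin d) (x : Site d) : τ (covDerivFwd η U₀ μ f x) = 0 := by
  rw [covDerivFwd, ← Complex.coe_smul, map_smul, map_sub, apply_conjR τ hτ, hf, hf, sub_self, smul_zero]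

omit [Nontrivial 𝔸] in
/-- The backward covariant difference (1.1) of a `τ`-free configuration is `τ`-free. [cite: Balaban1985RegularSpaces, (1.1) p.76] -/
theorem apply_covDeriv (hτ : ∀ x y : 𝔸, τ (x * y) = τ (y * x)) {η : ℝ} (U₀ : Site d → Fin d → 𝔸ˣ) {f : Site d → 𝔸}
    (hf : ∀ x, τ (f x) = 0) (μ : Fin d) (x : Site d) : τ (covDeriv η U₀ μ f x) = 0 := by
  rw [covDeriv, ← Complex.coe_smul, map_smul, map_sub, apply_conjR τ hτ, hf, hf, sub_self, smul_zero]

omit [Nontrivial 𝔸] in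
/-- The covariant Laplacian (1.2) of a `τ`-free configuration is `τ`-free. [cite: Balaban1985RegularSpaces, (1.2) p.76] -/
theorem apply_covLap (hτ : ∀ x y : 𝔸, τ (x * y) = τ (y * x)) {η : ℝ} (U₀ : Site d → Fin d → 𝔸ˣ) {f : Site d → 𝔸}
    (hf : ∀ x, τ (f x) = 0) (x : Site d) : τ (covLap η U₀ f x) = 0 := by
  unfold covLap covDivB
  rw [map_sum]
  exact Finset.sum_eq_zero fun μ _ => apply_covDeriv τ hτ U₀ (fun z => apply_covDerivFwd τ hτ U₀ hf μ z) μ x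

end Stencils

/-! ## §2 The gauge parameter `λ′` of Proposition 5 is `τ`-free -/

section GaugeParam

variable (τ : 𝔸 →L[ℂ] ℂ)
variable {L k : ℕ} {η : ℝ} {Ω : ℕ → Set (Site d)} {Eb : ℕ → Set (Site d × Fin d)} {U₀ : Site d → Fin d → 𝔸ˣ}
  {A : Site d → Fin d → 𝔸} {DA : Site d → 𝔸}

/-- ★ **THE GAUGE PARAMETER OF PROPOSITION 5 AT `k` LEVELS IS `τ`-FREE.**  `B8Prop5GaugeParamKLevel.gaugeParam_kLevel` verbatim (letters `G′`,
`R`; the Sect. E correction `H_c`; the datum `D*A`, `A` at a unitary `U₀`; the windows and the smallness (1.103)∕(1.106)), PLUS: a continuous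
functional `τ` with (T1) `τ(xy) = τ(yx)` and (T2) `τ(log(eᵃeᵇ)) = τ(a) + τ(b)` for `‖a‖ + ‖b‖ ≤ ½`; `τ(D*A) = 0` on the `Ω_j`; `H_c` maps
`τ`-free configurations of the ¼α₄-ball to `τ`-free configurations; `R` maps `τ`-free-on-Ω data to `τ`-free-on-Ω values; `G′` maps
`τ`-free-on-Ω data to `τ`-free configurations.  CONCLUSION: that of `gaugeParam_kLevel` (fixed point `s`, gauge parameter `s′` with
`λ_{s′} = λ_s + H_c λ_s`, `‖s′‖ ≤ α₄`, Hermitian, `= 0` off `Ω₀`, the Neumann identity) AND `τ(λ_{s′}(x)) = 0` at every site (print: `λ′` is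
`𝔤`-valued; for `M_N(ℂ)`, `τ = tr`: traceless, so `e^{iλ′} ∈ SU(N)`). [cite: Balaban1985RegularSpaces, Prop. 5 (1.107)–(1.108) p.94, (1.100)–(1.103) p.93, (1.17) p.78, (1.113)–(1.120) pp.95–96] -/
theorem gaugeParam_kLevel_traceFree (hτ : ∀ x y : 𝔸, τ (x * y) = τ (y * x))
    (hlog : ∀ a b : 𝔸, ‖a‖ + ‖b‖ ≤ 1 / 2 → τ (mlog (exp a * exp b)) = τ a + τ b)
    (hL : 1 ≤ L) (hη : 0 < η) (hU₀ : ∀ x κ, U₀ x κ ∈ unitaryUnits 𝔸)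
    (hEbΩ : ∀ j, j ≤ k → ∀ x ∈ Ω j, ∀ μ : Fin d, (x, μ) ∈ Eb j ∧ (x - e μ, μ) ∈ Eb j)
    (Gp R Hc : (Site d → 𝔸) → (Site d → 𝔸))
    {α₄ BG BR h₀ h₁ h₂ l₀ l₁ l₂ cA cDA : ℝ}
    (hα₄ : 0 ≤ α₄) (hBG : 0 ≤ BG) (hBR : 0 ≤ BR) (hh₀ : 0 ≤ h₀) (hh₂ : 0 ≤ h₂) (hl₀ : 0 ≤ l₀) (hl₁ : 0 ≤ l₁)
    (hl₂ : 0 ≤ l₂) (hcA : 0 ≤ cA) (hcA' : cA ≤ 1 / 13) (hcDA : 0 ≤ cDA)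
    (ha₁' : α₄ / 4 + h₀ ≤ 1 / 24) (hb₁' : α₄ / 4 + h₁ ≤ 1 / 140) (hb₁ : 0 < α₄ / 4 + h₁) (hθ : 10 * (α₄ / 4 + h₀) * BR ≤ 1 / 2)
    (hh₀' : h₀ ≤ 3 * α₄ / 4) (hh₁' : h₁ ≤ 3 * α₄ / 4)
    -- letters
    (hG : ∀ (f : Site d → 𝔸) (m : ℝ), 0 ≤ m → Bd2 L η k Ω f m →
      (∀ x, ‖Gp f x‖ ≤ BG * m) ∧ ∀ j, j ≤ k → ∀ p ∈ Eb j, wt L η j * ‖covDerivFwd η U₀ p.2 (Gp f) p.1‖ ≤ BG * m)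
    (hGsub : ∀ f g : Site d → 𝔸, Gp (f - g) = Gp f - Gp g)
    (hGsupp : ∀ (f : Site d → 𝔸) (x : Site d), x ∉ Ω 0 → Gp f x = 0)
    (hGreal : ∀ f : Site d → 𝔸, (∀ j, j ≤ k → ∀ x ∈ Ω j, IsSelfAdjoint (f x)) → ∀ x, IsSelfAdjoint (Gp f x))
    (hRsub : ∀ f g : Site d → 𝔸, R (f - g) = R f - R g)
    (hRbd : ∀ (f : Site d → 𝔸) (m : ℝ), 0 ≤ m → Bd2 L η k Ω f m → Bd2 L η k Ω (R f) (BR * m))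
    (hRreal : ∀ f : Site d → 𝔸, (∀ j, j ≤ k → ∀ x ∈ Ω j, IsSelfAdjoint (f x)) → ∀ j, j ≤ k → ∀ x ∈ Ω j, IsSelfAdjoint (R f x))
    -- the Sect. E correction `H_c` (λ′ = λ + H_c λ)
    (hc0 : ∀ s : lamSubK η U₀ L k Eb, ‖s‖ ≤ α₄ / 4 → ∀ x, ‖Hc (lamOf s) x‖ ≤ h₀)
    (hc1 : ∀ s : lamSubK η U₀ L k Eb, ‖s‖ ≤ α₄ / 4 → ∀ j, j ≤ k → ∀ p ∈ Eb j, wt L η j * ‖covDerivFwd η U₀ p.2 (Hc (lamOf s)) p.1‖ ≤ h₁)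
    (hc2 : ∀ s : lamSubK η U₀ L k Eb, ‖s‖ ≤ α₄ / 4 → Bd2 L η k Ω (covLap η U₀ (Hc (lamOf s))) h₂)
    (hcL0 : ∀ s t : lamSubK η U₀ L k Eb, ‖s‖ ≤ α₄ / 4 → ‖t‖ ≤ α₄ / 4 → ∀ x, ‖Hc (lamOf s) x - Hc (lamOf t) x‖ ≤ l₀ * ‖s - t‖)
    (hcL1 : ∀ s t : lamSubK η U₀ L k Eb, ‖s‖ ≤ α₄ / 4 → ‖t‖ ≤ α₄ / 4 → ∀ j, j ≤ k → ∀ p ∈ Eb j,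
      wt L η j * ‖covDerivFwd η U₀ p.2 (Hc (lamOf s) - Hc (lamOf t)) p.1‖ ≤ l₁ * ‖s - t‖)
    (hcL2 : ∀ s t : lamSubK η U₀ L k Eb, ‖s‖ ≤ α₄ / 4 → ‖t‖ ≤ α₄ / 4 →
      Bd2 L η k Ω (covLap η U₀ (Hc (lamOf s)) - covLap η U₀ (Hc (lamOf t))) (l₂ * ‖s - t‖))
    (hcsa : ∀ s : lamSubK η U₀ L k Eb, ‖s‖ ≤ α₄ / 4 → (∀ x, IsSelfAdjoint (lamOf s x)) → ∀ x, IsSelfAdjoint (Hc (lamOf s) x))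
    (hcsupp : ∀ s : lamSubK η U₀ L k Eb, ‖s‖ ≤ α₄ / 4 → ∀ x, x ∉ Ω 0 → Hc (lamOf s) x = 0)
    -- the datum
    (hDA : Bd2 L η k Ω DA cDA) (hDAsa : ∀ j, j ≤ k → ∀ x ∈ Ω j, IsSelfAdjoint (DA x))
    (hA : ∀ j, j ≤ k → ∀ x ∈ Ω j, ∀ μ : Fin d,
      wt L η j * ‖A x μ‖ ≤ cA ∧ wt L η j * ‖conjR (U₀ (x - e μ) μ)⁻¹ (A (x - e μ) μ)‖ ≤ cA)
    (hAsa : ∀ x μ, IsSelfAdjoint (A x μ))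
    -- smallness (1.103)/(1.106) on the explicit constants of the contraction
    (h103 : BG * Mc d BR (α₄ / 4 + h₁) cA h₂ cDA ≤ α₄ / 4)
    (h106 : BG * Kc d BR (α₄ / 4 + h₁) cA h₂ cDA l₂ (1 + l₀) (1 + l₁) ≤ 1 / 2)
    -- `τ`-freeness of the datum, the correction and the letters
    (hDAτ : ∀ j, j ≤ k → ∀ x ∈ Ω j, τ (DA x) = 0)
    (hcτ : ∀ s : lamSubK η U₀ L k Eb, ‖s‖ ≤ α₄ / 4 → (∀ x, τ (lamOf s x) = 0) → ∀ x, τ (Hc (lamOf s) x) = 0)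
    (hRτ : ∀ f : Site d → 𝔸, (∀ j, j ≤ k → ∀ x ∈ Ω j, τ (f x) = 0) → ∀ j, j ≤ k → ∀ x ∈ Ω j, τ (R f x) = 0)
    (hGτ : ∀ f : Site d → 𝔸, (∀ j, j ≤ k → ∀ x ∈ Ω j, τ (f x) = 0) → ∀ x, τ (Gp f x) = 0) :
    ∃ s s' : lamSubK η U₀ L k Eb,
      ‖s‖ ≤ α₄ / 4 ∧
      lamOf s = Gp (PsiP5 η U₀ A DA R (fun lam => lam + Hc lam) (fun lam => covLap η U₀ (Hc lam)) (lamOf s)) ∧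
      lamOf s' = lamOf s + Hc (lamOf s) ∧ ‖s'‖ ≤ α₄ ∧ (∀ x, IsSelfAdjoint (lamOf s' x)) ∧ (∀ x, x ∉ Ω 0 → lamOf s' x = 0) ∧
      (∀ j, j ≤ k → ∀ x ∈ Ω j,
        Zsol (Wsrc η U₀ A DA (lamOf s') (covLap η U₀ (Hc (lamOf s)))) (Vop (lamOf s')) R x +
          Vop (lamOf s') (R (Zsol (Wsrc η U₀ A DA (lamOf s') (covLap η U₀ (Hc (lamOf s)))) (Vop (lamOf s')) R)) x =
        Wsrc η U₀ A DA (lamOf s') (covLap η U₀ (Hc (lamOf s))) x) ∧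
      (∀ x, τ (lamOf s' x) = 0) := by
  obtain ⟨s, s', hs, hfix, hs', hn', hsa', hoff', hN⟩ := gaugeParam_kLevel (Ω := Ω) (Eb := Eb) (U₀ := U₀) (A := A) (DA := DA) hL hη hU₀
    hEbΩ Gp R Hc hα₄ hBG hBR hh₀ hh₂ hl₀ hl₁ hl₂ hcA hcA' hcDA ha₁' hb₁' hb₁ hθ hh₀' hh₁' hG hGsub hGsupp hGreal hRsub hRbd hRreal hc0 hc1 hc2
    hcL0 hcL1 hcL2 hcsa hcsupp hDA hDAsa hA hAsa h103 h106
  refine ⟨s, s', hs, hfix, hs', hn', hsa', hoff', hN, ?_⟩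
  -- the displayed hypotheses of the contraction at `gpar λ = λ + H_c λ`, `Eterm λ = ΔH_c λ`
  set gpar : (Site d → 𝔸) → (Site d → 𝔸) := fun lam => lam + Hc lam with hgpar
  set Eterm : (Site d → 𝔸) → (Site d → 𝔸) := fun lam => covLap η U₀ (Hc lam) with hEterm
  have hg0 : ∀ s : lamSubK η U₀ L k Eb, ‖s‖ ≤ α₄ / 4 → ∀ j, j ≤ k → ∀ x ∈ Ω j, ‖gpar (lamOf s) x‖ ≤ α₄ / 4 + h₀ :=
    fun s hs j _ x _ => gpar_size hc0 s hs x
  have hg1 : ∀ s : lamSubK η U₀ L k Eb, ‖s‖ ≤ α₄ / 4 → ∀ j, j ≤ k → ∀ x ∈ Ω j, ∀ μ : Fin d,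
      wt L η j * ‖covDerivFwd η U₀ μ (gpar (lamOf s)) x‖ ≤ α₄ / 4 + h₁ ∧ wt L η j * ‖covDeriv η U₀ μ (gpar (lamOf s)) x‖ ≤ α₄ / 4 + h₁ :=
    fun s hs j hj x hx μ => gpar_grad hη hU₀ hEbΩ hc1 s hs hj hx μ
  have hgL : ∀ s t : lamSubK η U₀ L k Eb, ‖s‖ ≤ α₄ / 4 → ‖t‖ ≤ α₄ / 4 → ∀ j, j ≤ k → ∀ x ∈ Ω j,
      ‖gpar (lamOf s) x - gpar (lamOf t) x‖ ≤ (1 + l₀) * ‖s - t‖ ∧ ∀ μ : Fin d,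
        wt L η j * ‖covDerivFwd η U₀ μ (gpar (lamOf s) - gpar (lamOf t)) x‖ ≤ (1 + l₁) * ‖s - t‖ ∧
        wt L η j * ‖covDeriv η U₀ μ (gpar (lamOf s) - gpar (lamOf t)) x‖ ≤ (1 + l₁) * ‖s - t‖ :=
    fun s t hs ht j hj x hx => gpar_lip hη hU₀ hEbΩ hcL0 hcL1 s t hs ht hj hx
  have hE0 : ∀ s : lamSubK η U₀ L k Eb, ‖s‖ ≤ α₄ / 4 → Bd2 L η k Ω (Eterm (lamOf s)) h₂ := fun s hs => hc2 s hs
  have hEL : ∀ s t : lamSubK η U₀ L k Eb, ‖s‖ ≤ α₄ / 4 → ‖t‖ ≤ α₄ / 4 →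
      Bd2 L η k Ω (Eterm (lamOf s) - Eterm (lamOf t)) (l₂ * ‖s - t‖) := fun s t hs ht => hcL2 s t hs ht
  have hEτ : ∀ t : lamSubK η U₀ L k Eb, ‖t‖ ≤ α₄ / 4 → (∀ x, τ (lamOf t x) = 0) → ∀ j, j ≤ k → ∀ x ∈ Ω j,
      τ (Eterm (lamOf t) x) = 0 := fun t ht htf j _ x _ => apply_covLap τ hτ U₀ (hcτ t ht htf) x
  -- layer 1: the fixed point is `τ`-free
  have hsτ : ∀ x, τ (lamOf s x) = 0 :=
    propFive_fixedPoint_kLevel_traceFree (Ω := Ω) (Eb := Eb) (U₀ := U₀) (A := A) (DA := DA) τ hτ hlog hL hη Gp R gpar Eterm hα₄ hBG hBR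
      (by positivity) ha₁' hb₁ hb₁' hcA hcA' hcDA hh₂ hl₂ (by positivity) (by positivity) hθ hG hGsub hRsub hRbd hg0 hg1 hgL hE0 hEL hDA hA
      h103 h106 hDAτ hEτ hRτ hGτ hs hfix
  intro x
  rw [hs', Pi.add_apply, map_add, hsτ x, hcτ s hs hsτ x, add_zero]

end GaugeParam

#print axioms gaugeParam_kLevel_traceFree

end Literature.MathematicalPhysics.QuantumFieldTheory.Balaban1983to89.B8Prop5GaugeParamTraceFree

end
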